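import Literature.AnabelianGeometry.EtaleTheta.BiKummerThm44SubFrdI

/-!
# [EtTh] Theorem 4.4: the base categories `D_i = B^temp(X_i^log)[𝒟_i]` are of FSM-type ⇐ Rmk 3.7.2 —
# proof-only companion (sub-DAG `plan/L2/SUBDAG-EtTh-Thm44.md`, standing hypothesis (α) "`D_i` of FSM-type")

S. Mochizuki, *The étale theta function …*, Publ. RIMS **45** (2009) [MochizukiEtTh2009], §4, Thm 4.4 proof,
PDF p.94 l.−4: "the base category `D_i` of `C_i` is slim [cf. Remark 3.7.2]" — and, for the [FrdI] Thm 3.4 input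
of the proof (row T44-L03, `BiKummerThm44SubFrdI.lean`), of FSM-type: Rmk 3.7.2 (PDF p.80) "`D₀` is slim … and
of FSM-, hence also of FSMFF-, type [cf. [FrdII], Example 1.3, (i)]" (tree: the named `Prop`
`TemperedFrobenioid.Remark372 D₀`).  The hypothesis structure `Thm44Hyp` renders "`D_i := B^temp(X_i^log)[𝒟_i]`"
as: `Base : D_i ⥤ D₀` fully faithful with essential image the objects admitting an arrow to `𝒟_i`
(`baseShape_i`).  Here ([FrdI] §0 p.14, "categories of FSM-type"): a category with a fully faithful functor
into a category of FSM-type whose essential image is closed under domains of arrows is of FSM-type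
(`isOfFSMType_of_fullyFaithful`; cf. the tree's `IsOfFSMType.fullSubcategory` for literal full
subcategories), hence `D₁`, `D₂` are of FSM-type as soon as `D₀`, `D₀'` are (`Thm44Hyp.isOfFSMType_base₁/₂`),
and Thm 4.4 (i)/(iii) hold modulo {`C_i` Frobenioids, `Remark372 D₀ / D₀'`, `Φ_i` non-dilating, the [SemiAnbd] /
[FrdII] input rows} (`thm44_i_of_remark372`, `thm44_iii_of_remark372`).
HONEST FRAMING: refereed pre-IUT material; nothing here bears on [IUTchIII] Cor. 3.12; typed ≠ proved.
-/

namespace Literature.AnabelianGeometry.EtaleTheta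

open CategoryTheory Opposite Literature.AlgebraicGeometry.Frobenioids

namespace BiKummerSetting

universe u₀ v₀ u v w

/-- **A category fully faithfully embedded in a category of FSM-type, with essential image closed under
domains of arrows, is of FSM-type** ([FrdI] §0 p.14): the embedding carries FSM-morphisms to FSM-morphisms
(monomorphy and fiberwise-surjectivity are tested on objects of the essential image) and reflects
isomorphisms. [cite: MochizukiFrdI2008, §0 p.14] -/
theorem isOfFSMType_of_fullyFaithful {D : Type u} [Category.{v} D] {D₀ : Type u₀} [Category.{v₀} D₀]
    (ι : D ⥤ D₀) [ι.Full] [ι.Faithful]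
    (hclosed : ∀ ⦃Z : D₀⦄ ⦃A : D⦄, (Z ⟶ ι.obj A) → ∃ A' : D, Nonempty (ι.obj A' ≅ Z))
    (h₀ : IsOfFSMType D₀) : IsOfFSMType D := by
  refine ⟨fun {A B} f hf => ?_⟩
  haveI : Mono f := hf.2
  have hmono : Mono (ι.map f) := ⟨fun {Z} g₁ g₂ hg => by
    obtain ⟨Z', ⟨e⟩⟩ := hclosed g₁
    have h1 : ι.map (ι.preimage (e.hom ≫ g₁) ≫ f) = ι.map (ι.preimage (e.hom ≫ g₂) ≫ f) := by
      rw [ι.map_comp, ι.map_comp, ι.map_preimage, ι.map_preimage, Category.assoc, Category.assoc, hg]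
    have h2 := ι.map_injective h1
    rw [cancel_mono] at h2
    have h3 := congrArg ι.map h2
    rw [ι.map_preimage, ι.map_preimage] at h3
    exact (cancel_epi e.hom).1 h3⟩
  have hfs : IsFiberwiseSurjective (ι.map f) := fun X γ => by
    obtain ⟨X', ⟨e⟩⟩ := hclosed γ
    obtain ⟨D', δA, δX', hδ⟩ := hf.1 (ι.preimage (e.hom ≫ γ))
    refine ⟨ι.obj D', ι.map δA, ι.map δX' ≫ e.hom, ?_⟩
    rw [← ι.map_comp, hδ, ι.map_comp, ι.map_preimage, Category.assoc]
  haveI := h₀.isIso_of_isFSM (ι.map f) ⟨hfs, hmono⟩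
  exact isIso_of_fully_faithful ι f

variable {K : Type u₀} [Field K] {K' : Type u₀} [Field K'] {D₀ : Type u₀} [Category.{v₀} D₀]
  {V : FrdIMonoidStub.{w}}
  {X₁ : SemiGraphs.TemperedArithmeticGroup.{u₀} K} {X₂ : SemiGraphs.TemperedArithmeticGroup.{u₀} K'}
  {D₀' : Type u₀} [Category.{v₀} D₀']
  {T₁ : RealifiedDivisorMonoids (D₀ := D₀) V} {T₂ : RealifiedDivisorMonoids (D₀ := D₀') V}
  {D₁ D₂ : Type u} [Category.{v} D₁] [Category.{v} D₂] {VD₁ : FrdICatStub.{u, v, w} D₁}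
  {VD₂ : FrdICatStub.{u, v, w} D₂} {S₁ : BiKummerSetting X₁ T₁ D₁ VD₁} {S₂ : BiKummerSetting X₂ T₂ D₂ VD₂}

/-- **`D₁ = B^temp(X₁^log)[𝒟₁]` is of FSM-type when `D₀ = B^temp(X₁^log)` is** (Rmk 3.7.2), through
`Thm44Hyp.baseShape₁`: the essential image of `Base : D₁ ⥤ D₀` (objects with an arrow to `𝒟₁`) is closed under
domains of arrows. [cite: MochizukiEtTh2009, Rmk 3.7.2 p.80] -/
theorem Thm44Hyp.isOfFSMType_base₁ (h : Thm44Hyp S₁ S₂) (h₀ : IsOfFSMType D₀) : IsOfFSMType D₁ := by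
  obtain ⟨hfull, hfaith, 𝒟, h𝒟⟩ := h.baseShape₁
  refine isOfFSMType_of_fullyFaithful S₁.tf.base (fun Z A g => ?_) h₀
  have hA : Nonempty (S₁.tf.base.obj A ⟶ 𝒟) := (h𝒟 _).1 ⟨A, ⟨Iso.refl _⟩⟩
  exact (h𝒟 Z).2 ⟨g ≫ hA.some⟩

/-- **`D₂ = B^temp(X₂^log)[𝒟₂]` is of FSM-type when `D₀' = B^temp(X₂^log)` is** (Rmk 3.7.2), through
`Thm44Hyp.baseShape₂`. [cite: MochizukiEtTh2009, Rmk 3.7.2 p.80] -/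
theorem Thm44Hyp.isOfFSMType_base₂ (h : Thm44Hyp S₁ S₂) (h₀ : IsOfFSMType D₀') : IsOfFSMType D₂ := by
  obtain ⟨hfull, hfaith, 𝒟, h𝒟⟩ := h.baseShape₂
  refine isOfFSMType_of_fullyFaithful S₂.tf.base (fun Z A g => ?_) h₀
  have hA : Nonempty (S₂.tf.base.obj A ⟶ 𝒟) := (h𝒟 _).1 ⟨A, ⟨Iso.refl _⟩⟩
  exact (h𝒟 Z).2 ⟨g ≫ hA.some⟩

/-- **Thm 4.4 (i) modulo Rmk 3.7.2**: `Thm44_i h` from "`C₁, C₂` are Frobenioids" ([FrdI] Thm 5.2 (ii)), the named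
fact `Remark372` for `D₀`, `D₀'` ([SemiAnbd] Ex 3.10 / [FrdII] Ex 1.3 (i)), "`Φ₁, Φ₂` non-dilating" (hypothesis of
Thm 4.4, [FrdI] vocabulary) and the [SemiAnbd] input rows T44-L09c, T44-L09. [cite: MochizukiEtTh2009, Thm 4.4 p.94] -/
theorem Thm44Hyp.thm44_i_of_remark372 (h : Thm44Hyp S₁ S₂)
    (hF₁ : PreFrobenioid.IsFrobenioid S₁.F) (hF₂ : PreFrobenioid.IsFrobenioid S₂.F)
    (h372 : TemperedFrobenioid.Remark372 D₀) (h372' : TemperedFrobenioid.Remark372 D₀')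
    (hnd₁ : (PreFrobenioidData.ofFunctor S₁.tf.divisorMonoid S₁.F).IsNonDilatingOn)
    (hnd₂ : (PreFrobenioidData.ofFunctor S₂.tf.divisorMonoid S₂.F).IsNonDilatingOn)
    (h9c : h.GaloisCompatible) (h9 : h.HodotCompatible) : Thm44_i h :=
  h.thm44_i_of_thm34 hF₁ hF₂ (h.isOfFSMType_base₁ h372.2.1) (h.isOfFSMType_base₂ h372'.2.1) hnd₁ hnd₂ h9c h9

/-- **Thm 4.4 (iii) (saturation clause, v5) modulo Rmk 3.7.2**: `Thm44_iii h ψ` from "`C₁, C₂` Frobenioids",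
`Remark372 D₀ / D₀'`, "`Φ₁, Φ₂` non-dilating" and the [FrdII] Def 2.2 (ii) input row T44-L15b.
[cite: MochizukiEtTh2009, Thm 4.4 p.94] -/
theorem Thm44Hyp.thm44_iii_of_remark372 (h : Thm44Hyp S₁ S₂)
    (ψ : ∀ A : S₁.C, S₁.biratUnits A ≃* S₂.biratUnits (h.Ψ.functor.obj A))
    (hF₁ : PreFrobenioid.IsFrobenioid S₁.F) (hF₂ : PreFrobenioid.IsFrobenioid S₂.F)
    (h372 : TemperedFrobenioid.Remark372 D₀) (h372' : TemperedFrobenioid.Remark372 D₀')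
    (hnd₁ : (PreFrobenioidData.ofFunctor S₁.tf.divisorMonoid S₁.F).IsNonDilatingOn)
    (hnd₂ : (PreFrobenioidData.ofFunctor S₂.tf.divisorMonoid S₂.F).IsNonDilatingOn)
    (h15 : h.PreservesNHSaturatedBsFld) : Thm44_iii h ψ :=
  h.thm44_iii_of_thm34 ψ hF₁ hF₂ (h.isOfFSMType_base₁ h372.2.1) (h.isOfFSMType_base₂ h372'.2.1) hnd₁ hnd₂ h15

end BiKummerSetting

end Literature.AnabelianGeometry.EtaleTheta
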